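import Summits.KontsevichZagierPeriods.KontsevichZagierPeriods.Theorems.RootDecompQuadraticDescentEisensteinPairP8
import Summits.KontsevichZagierPeriods.KontsevichZagierPeriods.Theses.RootDecompQuadraticDescent

/-!
# Census pair #22 (the ℚ(√−3) pair 4·[□²,1/(3−2N)] ≡ 5·[□²,1/(3−N)], N = u²−uv+v²) and #0 DECIDED in `KZ.relations` by rules 1+2 (route `RootDecompQuadraticDescent`, instances of crux stmt-KontsevichZagierPeriods-28994 / stmt-4280) · part 9/9

Cell `decomp-kz`, lens 6 (decomp-kz-lens-6 g7): `pair22` (NO Stokes; blow-up + conic log band + seven ℚ-rational base substitutions; every piecewise-affine chain certified impossible) and `pair0`; packaged `pairs_decided`, `pairs_descentTwoQ_instances`, `pairs_of_kzDimTwo` BY NAME.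

Source: `HOME/decomp-kz-lens-6/g7/EisensteinPair22.lean` sha256 fdb5e0bbc5a4a341 (1894 l; critic decomp-kz-crit-1 g2 CLEARED 2026-08-30T07:59:44Z, std axioms), split by the landing seat decomp-kz-census-1 g7 (earlier parts as landed; the remainder re-cut smaller to respect the 400-line policy after private dedup copies); the route file is imported only by the last part.  No `sorry`; standard axioms.  References: [cite: KontsevichZagier2001, §1.2].
-/

noncomputable section

open MeasureTheory Set MvPolynomial

namespace Summit.KontsevichZagierPeriods.RootDecompQuadraticDescent.EisensteinPair

open Literature.NumberTheory.Transcendental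
open Literature.NumberTheory.Transcendental.KZ
open Literature.ModelTheory.ExponentialFields (IsSemialgebraic)

open Summit.KontsevichZagierPeriods.KontsevichZagierPeriods.Theses.RootDecompQuadraticDescent

-- PRIVATE copy (the lemma is private in an earlier landed part):
/-- `w = snoc (init w) 0 + w_last • (0,…,0,1)`: the splitting of `ℝᵐ⁺¹ = ℝᵐ × ℝ` used in the Jacobian
computation of `KZ.of_sub_of_mem_relations_of_fibreMap`. (Source: cell `decomp-kz`, lens 2 gen 4,
`RationalCubeDichotomy.lean` v5, sha256 `eccce7f4…`, l. 1699.) [folklore] -/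
private theorem eq_snoc_init_zero_add' (m : ℕ) (w : Fin (m + 1) → ℝ) :
    w = Fin.snoc (Fin.init w) (0 : ℝ) + w (Fin.last m) • (Pi.single (Fin.last m) (1 : ℝ) : Fin (m + 1) → ℝ) := by
  ext i
  refine Fin.lastCases ?_ (fun j => ?_) i
  · simp
  · simp [(Fin.castSucc_lt_last j).ne, Fin.init]

-- PRIVATE copy (landed twin elsewhere; dedup.landed): snoc2_zero, snoc2_one, init2_zero, isRational_rep, of_sub_of_mem_relations_of_fibreMap'
/-- `snoc2_zero`: auxiliary theorem of the lens-6 development «eis» (instances of 28994/4280) — see the module docstring; verbatim from the lens file. -/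
@[simp] private theorem snoc2_zero (x : Fin 1 → ℝ) (t : ℝ) : (Fin.snoc x t : Fin 2 → ℝ) 0 = x 0 := rfl

/-- `snoc2_one`: auxiliary theorem of the lens-6 development «eis» (instances of 28994/4280) — see the module docstring; verbatim from the lens file. -/
@[simp] private theorem snoc2_one (x : Fin 1 → ℝ) (t : ℝ) : (Fin.snoc x t : Fin 2 → ℝ) 1 = t := rfl

/-- `init2_zero`: auxiliary theorem of the lens-6 development «eis» (instances of 28994/4280) — see the module docstring; verbatim from the lens file. -/
@[simp] private theorem init2_zero (z : Fin 2 → ℝ) : Fin.init z 0 = z 0 := rfl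

/-- A regular rational function gives a KZ-rational representation. [folklore] -/
private theorem isRational_rep {M : ℕ} (T : RFun M) : T.rep.IsRational :=
  ⟨T.num, T.den, T.den_ne, fun _ _ => rfl⟩

/-- **Fibred substitution with a Jacobian allowed to vanish on the lower edge.** Verbatim copy of
`KZ.of_sub_of_mem_relations_of_fibreMap` (Literature/NumberTheory/Transcendental/KZFibreMapMove.lean)
with the hypothesis `0 < ψs` weakened to the OPEN fibres `a y < s < b y` plus `0 ≤ ψs` on the closed
band — exactly what strict monotonicity (`strictMonoOn_of_deriv_pos` on the interior) and the
integrand identity (`|det| = ψs`) use. Needed here because the substitution `s ↦ 3/(3 − μs²q(u))`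
has `∂/∂s = 0` on the edge `s = 0` (the exceptional divisor of the blow-up).
[cite: KontsevichZagier2001, §1.2 rule 2] -/
private theorem of_sub_of_mem_relations_of_fibreMap' {m : ℕ} {G : Set (Fin m → ℝ)}
    {a b a' b' : (Fin m → ℝ) → ℝ} (ψ ψs : (Fin (m + 1) → ℝ) → ℝ)
    (r r' : IntegralRep (m + 1)) (hr : r.domain = KZlog.band G a b)
    (hr' : r'.domain = KZlog.band G a' b') (hab : ∀ y ∈ G, a y ≤ b y)
    (hψ : IsSemialgebraicFunOn ℚ r.domain ψ)
    (hψd : ∀ z ∈ r.domain, DifferentiableAt ℝ ψ z)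
    (hψs : ∀ z ∈ r.domain,
      HasDerivAt (fun t : ℝ => ψ (Fin.snoc (Fin.init z) t)) (ψs z) (z (Fin.last m)))
    (hpos : ∀ z ∈ r.domain, a (Fin.init z) < z (Fin.last m) → z (Fin.last m) < b (Fin.init z) → 0 < ψs z)
    (hnn : ∀ z ∈ r.domain, 0 ≤ ψs z)
    (ha : ∀ y ∈ G, ψ (Fin.snoc y (a y)) = a' y) (hb : ∀ y ∈ G, ψ (Fin.snoc y (b y)) = b' y)
    (hint : ∀ z ∈ r.domain, r.integrand z = r'.integrand (Fin.snoc (Fin.init z) (ψ z)) * ψs z) :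
    of r - of r' ∈ relations := by
  have hmemG : ∀ z ∈ r.domain, Fin.init z ∈ G := fun z hz => by
    rw [hr] at hz
    exact hz.1
  have hsnoc_mem : ∀ y ∈ G, ∀ t ∈ Icc (a y) (b y), (Fin.snoc y t : Fin (m + 1) → ℝ) ∈ r.domain := by
    intro y hy t ht
    rw [hr, KZlog.snoc_mem_band]
    exact ⟨hy, ht⟩
  -- the fibre maps
  have hfib_deriv : ∀ y ∈ G, ∀ t ∈ Icc (a y) (b y),
      HasDerivAt (fun s : ℝ => ψ (Fin.snoc y s)) (ψs (Fin.snoc y t)) t := by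
    intro y hy t ht
    have h := hψs _ (hsnoc_mem y hy t ht)
    simpa only [Fin.init_snoc, Fin.snoc_last] using h
  have hfib_cont : ∀ y ∈ G, ContinuousOn (fun s : ℝ => ψ (Fin.snoc y s)) (Icc (a y) (b y)) :=
    fun y hy t ht => (hfib_deriv y hy t ht).continuousAt.continuousWithinAt
  have hfib_mono : ∀ y ∈ G, StrictMonoOn (fun s : ℝ => ψ (Fin.snoc y s)) (Icc (a y) (b y)) := by
    intro y hy
    refine strictMonoOn_of_deriv_pos (convex_Icc _ _) (hfib_cont y hy) fun t ht => ?_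
    rw [interior_Icc] at ht
    have hd := hfib_deriv y hy t (Ioo_subset_Icc_self ht)
    rw [hd.deriv]
    exact hpos _ (hsnoc_mem y hy t (Ioo_subset_Icc_self ht)) (by simpa using ht.1) (by simpa using ht.2)
  -- the substitution
  set Φ : (Fin (m + 1) → ℝ) → (Fin (m + 1) → ℝ) := fun z => Fin.snoc (Fin.init z) (ψ z) with hΦ
  let Φ' : (Fin (m + 1) → ℝ) → (Fin (m + 1) → ℝ) →L[ℝ] (Fin (m + 1) → ℝ) := fun z =>
    ContinuousLinearMap.pi
      (Fin.lastCases (motive := fun _ => (Fin (m + 1) → ℝ) →L[ℝ] ℝ) (fderiv ℝ ψ z)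
        (fun i => ContinuousLinearMap.proj (Fin.castSucc i)))
  have hΦ' : ∀ z w, Φ' z w = Fin.snoc (Fin.init w) (fderiv ℝ ψ z w) := by
    intro z w
    funext i
    refine Fin.lastCases ?_ (fun j => ?_) i
    · simp [Φ']
    · simp [Φ', Fin.init]
  -- the partial derivative along the last coordinate is `ψs`
  have hlast : ∀ z ∈ r.domain, fderiv ℝ ψ z (Pi.single (Fin.last m) 1) = ψs z := by
    intro z hz
    have hγ : HasDerivAt (fun t : ℝ => (Fin.snoc (Fin.init z) t : Fin (m + 1) → ℝ))
        (Pi.single (Fin.last m) (1 : ℝ)) (z (Fin.last m)) := by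
      rw [hasDerivAt_pi]
      intro i
      refine Fin.lastCases ?_ (fun j => ?_) i
      · simpa using hasDerivAt_id' (z (Fin.last m))
      · simpa [(Fin.castSucc_lt_last j).ne, Fin.init] using hasDerivAt_const (z (Fin.last m)) (z (Fin.castSucc j))
    have h1 : HasDerivAt (fun t : ℝ => ψ (Fin.snoc (Fin.init z) t))
        (fderiv ℝ ψ z (Pi.single (Fin.last m) 1)) (z (Fin.last m)) := by
      have hψz : HasFDerivAt ψ (fderiv ℝ ψ z) (Fin.snoc (Fin.init z) (z (Fin.last m))) := by
        rw [Fin.snoc_init_self]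
        exact (hψd z hz).hasFDerivAt
      exact hψz.comp_hasDerivAt (z (Fin.last m)) hγ
    exact h1.unique (hψs z hz)
  -- determinant
  have hdet : ∀ z ∈ r.domain, (Φ' z).det = ψs z := by
    intro z hz
    let E : (Fin m → ℝ) →ₗ[ℝ] (Fin (m + 1) → ℝ) :=
      LinearMap.pi (Fin.lastCases (motive := fun _ => (Fin m → ℝ) →ₗ[ℝ] ℝ) 0
        (fun i => LinearMap.proj i))
    have hE : ∀ y, E y = Fin.snoc y 0 := by
      intro y
      funext i
      refine Fin.lastCases ?_ (fun j => ?_) i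
      · simp [E]
      · simp [E]
    have h := LinearMap.det_of_snoc_init (Φ' z : (Fin (m + 1) → ℝ) →ₗ[ℝ] (Fin (m + 1) → ℝ))
      LinearMap.id ((fderiv ℝ ψ z : (Fin (m + 1) → ℝ) →ₗ[ℝ] ℝ).comp E)
      (fderiv ℝ ψ z (Pi.single (Fin.last m) 1)) (fun w => by
        rw [ContinuousLinearMap.coe_coe, hΦ', LinearMap.id_apply, LinearMap.comp_apply,
          ContinuousLinearMap.coe_coe, hE]
        congr 1
        conv_lhs => rw [eq_snoc_init_zero_add' m w]
        rw [map_add, map_smul, smul_eq_mul, mul_comm])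
    rw [LinearMap.det_id, mul_one, hlast z hz] at h
    exact h
  -- derivative
  have hderiv : ∀ z ∈ r.domain, HasFDerivAt Φ (Φ' z) z := by
    intro z hz
    rw [hasFDerivAt_pi']
    intro i
    refine Fin.lastCases ?_ (fun j => ?_) i
    · have hfun : (fun x => Φ x (Fin.last m)) = ψ := by
        funext x
        simp [hΦ]
      show HasFDerivAt (fun x => Φ x (Fin.last m)) _ z
      rw [hfun]
      refine (hψd z hz).hasFDerivAt.congr_fderiv (ContinuousLinearMap.ext fun w => ?_)
      simp [hΦ']
    · have hfun : (fun x => Φ x (Fin.castSucc j)) = fun x => x (Fin.castSucc j) := by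
        funext x
        simp [hΦ, Fin.init]
      show HasFDerivAt (fun x => Φ x (Fin.castSucc j)) _ z
      rw [hfun]
      refine (hasFDerivAt_apply (Fin.castSucc j) z).congr_fderiv
        (ContinuousLinearMap.ext fun w => ?_)
      simp [hΦ', Fin.init]
  refine changeOfVariablesRel_subset_relations ⟨m + 1, r, r', Φ, Φ', ?_, ?_, ?_, ?_, ?_, rfl⟩
  · -- semialgebraic map
    refine (isSemialgebraicMapOn_iff_forall_holds r.isSemialgebraic_domain).mpr fun i => ?_
    refine Fin.lastCases ?_ (fun j => ?_) i
    · exact hψ.congr fun z _ => by simp [hΦ]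
    · exact (isSemialgebraicFunOn_aeval r.isSemialgebraic_domain
        (MvPolynomial.X (Fin.castSucc j))).congr fun z _ => by simp [hΦ, Fin.init]
  · exact fun z hz => (hderiv z hz).hasFDerivWithinAt
  · -- injective
    intro z₁ hz₁ z₂ hz₂ h
    have hy : Fin.init z₁ = Fin.init z₂ := by
      have := congrArg Fin.init h
      simpa [hΦ] using this
    have hl : ψ z₁ = ψ z₂ := by
      have := congrFun h (Fin.last m)
      simpa [hΦ] using this
    have hyG : Fin.init z₂ ∈ G := hmemG z₂ hz₂
    have ht₁ : z₁ (Fin.last m) ∈ Icc (a (Fin.init z₂)) (b (Fin.init z₂)) := by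
      rw [hr] at hz₁; rw [← hy]; exact hz₁.2
    have ht₂ : z₂ (Fin.last m) ∈ Icc (a (Fin.init z₂)) (b (Fin.init z₂)) := by
      rw [hr] at hz₂; exact hz₂.2
    have hl' : ψ (Fin.snoc (Fin.init z₂) (z₁ (Fin.last m))) = ψ (Fin.snoc (Fin.init z₂) (z₂ (Fin.last m))) := by
      rw [Fin.snoc_init_self]
      conv_lhs => rw [← hy, Fin.snoc_init_self]
      exact hl
    have hs : z₁ (Fin.last m) = z₂ (Fin.last m) := (hfib_mono _ hyG).injOn ht₁ ht₂ hl'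
    rw [← Fin.snoc_init_self z₁, ← Fin.snoc_init_self z₂, hy, hs]
  · -- image
    rw [hr']
    ext w
    simp only [mem_image]
    constructor
    · intro hw
      rw [KZlog.mem_band] at hw
      obtain ⟨hy, hw1, hw2⟩ := hw
      have hab' := hab _ hy
      have hivt := intermediate_value_Icc hab' (hfib_cont _ hy)
      rw [ha _ hy, hb _ hy] at hivt
      obtain ⟨t, ht, hwt⟩ := hivt ⟨hw1, hw2⟩
      have hwt' : ψ (Fin.snoc (Fin.init w) t) = w (Fin.last m) := hwt
      refine ⟨Fin.snoc (Fin.init w) t, hsnoc_mem _ hy t ht, ?_⟩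
      simp only [hΦ, Fin.init_snoc]
      rw [hwt', Fin.snoc_init_self]
    · rintro ⟨z, hz, rfl⟩
      have hy : Fin.init z ∈ G := hmemG z hz
      have ht : z (Fin.last m) ∈ Icc (a (Fin.init z)) (b (Fin.init z)) := by
        rw [hr] at hz; exact hz.2
      have hmono := (hfib_mono _ hy).monotoneOn
      have haz : a (Fin.init z) ∈ Icc (a (Fin.init z)) (b (Fin.init z)) := left_mem_Icc.mpr (hab _ hy)
      have hbz : b (Fin.init z) ∈ Icc (a (Fin.init z)) (b (Fin.init z)) := right_mem_Icc.mpr (hab _ hy)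
      have h1 := hmono haz ht ht.1
      have h2 := hmono ht hbz ht.2
      simp only [ha _ hy, hb _ hy, Fin.snoc_init_self] at h1 h2
      rw [KZlog.mem_band]
      simp only [hΦ, Fin.init_snoc, Fin.snoc_last]
      exact ⟨hy, h1, h2⟩
  · intro z hz
    rw [hint z hz, hdet z hz, abs_of_nonneg (hnn z hz)]

section Census

/-- The projective substitution `y = x/(2 − x)` of `[0,1]` onto itself:
`[□², 1/(2−y+y²)] ≡ [□², 1/(1+y+2y²)]` since `1 + ψ + 2ψ² = 2(2−y+y²)/(2−y)²` and `dψ = 2dy/(2−y)²`. -/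
theorem B0swap_A0 : KZ.of (B0.rename (Equiv.swap 0 1)).rep - KZ.of A0.rep ∈ KZ.relations := by
  have h2 : ∀ z ∈ cube 2, (0 : ℝ) < 2 - z 1 := fun z hz => by linarith [(hz 1).2]
  refine of_sub_of_mem_relations_of_fibreMap' (G := ivl 0 1) (a := fun _ => 0) (b := fun _ => 1)
    (a' := fun _ => 0) (b' := fun _ => 1) (fun z => z 1 / (2 - z 1)) (fun z => 2 / (2 - z 1) ^ 2)
    _ A0.rep cube_eq_band cube_eq_band (fun _ _ => zero_le_one) ?_ ?_ ?_ ?_ ?_ ?_ ?_ ?_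
  · refine (isSemialgebraicFunOn_aeval_div_aeval isSemialgebraic_cube (X 1 : MvPolynomial (Fin 2) ℚ)
      (2 - X 1) fun z hz => ?_).congr fun z _ => ?_
    · have h := h2 z hz
      simp only [map_sub, map_ofNat, aeval_X]
      exact h.ne'
    · simp only [map_sub, map_ofNat, aeval_X]
  · intro z hz
    have hne := (h2 z hz).ne'
    fun_prop (disch := exact hne)
  · intro z hz
    have hne : -1 * z 1 + 2 ≠ 0 := by have := h2 z hz; linarith
    show HasDerivAt (fun t => (Fin.snoc (Fin.init z) t : Fin 2 → ℝ) 1 /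
      (2 - (Fin.snoc (Fin.init z) t : Fin 2 → ℝ) 1)) _ (z 1)
    simp only [snoc2_one]
    exact ((hasDerivAt_moebius 1 0 (-1) 2 (z 1) hne).congr_of_eventuallyEq
      (Filter.Eventually.of_forall fun s => by simp only [one_mul, add_zero]; ring)).congr_deriv (by ring)
  · intro z hz _ _
    exact div_pos two_pos (pow_pos (h2 z hz) 2)
  · intro z hz
    exact (div_pos two_pos (pow_pos (h2 z hz) 2)).le
  · intro y _
    show (Fin.snoc y (0 : ℝ) : Fin 2 → ℝ) 1 / (2 - (Fin.snoc y (0 : ℝ) : Fin 2 → ℝ) 1) = 0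
    simp
  · intro y _
    show (Fin.snoc y (1 : ℝ) : Fin 2 → ℝ) 1 / (2 - (Fin.snoc y (1 : ℝ) : Fin 2 → ℝ) 1) = 1
    norm_num [snoc2_one]
  · intro z hz
    have hne := (h2 z hz).ne'
    have hq : (2 : ℝ) - z 1 + z 1 ^ 2 ≠ 0 := by nlinarith [sq_nonneg (z 1 - 1 / 2)]
    rw [RFun.rep_integrand, RFun.fn_rename, RFun.rep_integrand]
    simp only [RFun.fn, A0, B0, QA0, QB0, map_sub, map_mul, map_add, map_pow, map_ofNat, map_one,
      aeval_X, Function.comp_apply, Equiv.swap_apply_left, snoc2_one]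
    rw [show (1 : ℝ) + z 1 / (2 - z 1) + 2 * (z 1 / (2 - z 1)) ^ 2 = 2 * (2 - z 1 + z 1 ^ 2) / (2 - z 1) ^ 2 by
      field_simp; ring]
    field_simp

/-- **Census pair #0 DECIDED**: `[□², 1/(1+y+2y²)] − [□², 1/(2−x+x²)] ∈ KZ.relations`, by ONE
projective (non-affine) substitution `y = x/(2−x)` after relabelling — the pair the census types
`INDEP/INDEP · dark · UNEXPLAINED by folds` (its common value is `(4/√7)·arctan(1/√7)`·const, a
BakerFloorOne-type number, but no transcendence input is needed for the RELATION). -/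
theorem pair0 : KZ.of A0.rep - KZ.of B0.rep ∈ KZ.relations := by
  have h := add_mem (RFun.rel_rename B0 (Equiv.swap 0 1)) B0swap_A0
  convert neg_mem h using 1
  abel

/-- `pair0_equivalent`: auxiliary theorem of the lens-6 development «eis» (instances of 28994/4280) — see the module docstring; verbatim from the lens file. -/
theorem pair0_equivalent : KZ.Equivalent A0.rep B0.rep := pair0

/-- `pair0_value`: auxiliary theorem of the lens-6 development «eis» (instances of 28994/4280) — see the module docstring; verbatim from the lens file. -/
theorem pair0_value : A0.rep.value = B0.rep.value :=
  KZ.Equivalent.value_eq_holds pair0_equivalent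

/-! ## The two pairs as DECIDED INSTANCES of the route items -/

/-- Both census pairs are equal-valued pairs of two-dimensional KZ-rational representations on the
closed square whose difference is a relation — the conclusion of `KZDimTwo` (item 4280) ABSOLUTELY,
hence that of `DescentTwoQ` (item 28994) modulo every `R ⊇ KZ.relations`, whatever the oracle. -/
theorem pairs_decided :
    (A22four.rep.IsRational ∧ B22five.rep.IsRational ∧ A22four.rep.value = B22five.rep.value ∧
      KZ.Equivalent A22four.rep B22five.rep) ∧
    (A0.rep.IsRational ∧ B0.rep.IsRational ∧ A0.rep.value = B0.rep.value ∧ KZ.Equivalent A0.rep B0.rep) :=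
  ⟨⟨isRational_rep _, isRational_rep _, pair22_value, pair22_equivalent⟩,
   ⟨isRational_rep _, isRational_rep _, pair0_value, pair0_equivalent⟩⟩

/-- Relative form: the census differences lie in every additive subgroup `R ⊇ KZ.relations` — the
instances of the conclusion of `DescentTwoQ` (item 28994) at these pairs, with NO use of its oracle
hypotheses. -/
theorem pairs_descentTwoQ_instances (R : AddSubgroup KZ.FormalRep) (hR : KZ.relations ≤ R) :
    4 • KZ.of A22.rep - 5 • KZ.of B22.rep ∈ R ∧ KZ.of A22four.rep - KZ.of B22five.rep ∈ R ∧
      KZ.of A0.rep - KZ.of B0.rep ∈ R :=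
  ⟨hR pair22, hR pair22_equivalent, hR pair0⟩

/-- Sanity link to the route: `KZDimTwo` (item 4280) also yields these congruences (instances at
`n = m = 2`); the point of this file is that they hold unconditionally. -/
theorem pairs_of_kzDimTwo (h : KZDimTwo) :
    KZ.Equivalent A22four.rep B22five.rep ∧ KZ.Equivalent A0.rep B0.rep :=
  ⟨h le_rfl le_rfl _ _ (isRational_rep _) (isRational_rep _) pair22_value,
   h le_rfl le_rfl _ _ (isRational_rep _) (isRational_rep _) pair0_value⟩

/-- info: 'Summit.KontsevichZagierPeriods.RootDecompQuadraticDescent.EisensteinPair.pairs_decided' depends on axioms: [propext,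
 Classical.choice,
 Quot.sound] -/
#guard_msgs in #print axioms pairs_decided

/-- info: 'Summit.KontsevichZagierPeriods.RootDecompQuadraticDescent.EisensteinPair.pair22' depends on axioms: [propext,
 Classical.choice,
 Quot.sound] -/
#guard_msgs in #print axioms pair22

end Census

end Summit.KontsevichZagierPeriods.RootDecompQuadraticDescent.EisensteinPair

end
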